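import Summits.SmoothPoincare4.SmoothPoincare4.Theses.EntropyRung
import Literature.Geometry.Riemannian.GaussianShrinker
import Literature.Geometry.Riemannian.ShrinkingRoundSphereFour
import Literature.Geometry.Riemannian.RoundCylinderFourVolume
import Literature.Geometry.Riemannian.PuncturedShrinkingSphereFour

/-!
# Disproof of `NoncompactShrinkerGap` (item stmt-SmoothPoincare4-10868, route EntropyRung) — findings

Standing adversary file (refuter-cdisprove; gen 1 = cycles 1–2, 2026-08-15/16; gen 2 = cycle 3,
2026-08-16; v7 — every geometric core is LANDED in Literature and imported here: `GaussianShrinker.lean`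
(p68670), `ShrinkingRoundSphereFour.lean` (p68970), `RoundCylinderFour.lean` (p69907),
`RoundCylinderFourSoliton.lean` (p70042), `RoundCylinderFourVolume.lean` (p70345),
`PuncturedShrinkingSphereFour.lean` (p70622); the checked negative lemmas of §§(b),(c) are ALSO filed as
importable Theorems files `Summits/SmoothPoincare4/SmoothPoincare4/Theorems/NoncompactShrinkerGap/Negative/
{LoadBearingHypotheses,TightAtCylinder}.lean` (cycle 3, proposal ids in the item evidence notes); this file
is sorry-free except `noncompactShrinkerGap_false_without_connected`). Index:

1. **Formal audit of the typed statement — no junk kill.** `g.leviCivita` is the Koszul connection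
   (a real definition, unique), `ricci/scalarCurvature/hessian/gradSq` are genuine for smooth data,
   `g.edist` is Mathlib's `riemannianEDist`, `riemannianMeasure` is the Euclidean-normalised
   Hausdorff measure `μHE[4]` of the length metric (= `dV_g`). The constant
   `32 π² √π e^{-3/2} = (4π)² · Θ(S³×ℝ)` is exactly `∫ e^{-f} dV` of the round cylinder
   `S³(2) × ℝ`, `f = z²/4 + 3/2` — PROVED (`tight_at_cylinder`, `not_strict`): the cylinder was
   built this session as `(ℝ⁴∖0, (4/|y|²)δ)` in `Literature/Geometry/Riemannian/RoundCylinderFour*.lean`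
   (curvature via the conformal law, weighted volume via the chart formula + the substitution
   `t = eˣ` to a Gaussian, completeness via the 1-Lipschitz height). Also CHECKED (§3): the hypothesis bundle is satisfiable and computable in the
   tree's vocabulary — the Gaussian shrinker `(ℝ⁴, δ, |x|²/4)` meets every hypothesis except
   `∃ x, R x ≠ 0` and has `∫ e^{-f} dV = 16π² > 32π²√π e^{-3/2}` (so the bound is NOT vacuous and
   non-flatness is load-bearing): `noncompactShrinkerGap_false_without_nonflat` (sorry-free,
   axioms propext/choice/Quot.sound).
2. **Mathematical kill attempts — the crux resists.** Known complete non-compact non-flat 4-d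
   gradient shrinkers and their densities `Θ = (4π)⁻² ∫ e^{-f} dV` (CHI 2004 §4 table, p. 7,
   re-derived): `S³×ℝ` .791 (= bound), `S³/Γ×ℝ` .791/|Γ|, `S²×ℝ²` .736, FIK `L(2,-1)`
   .672 = `e^{√2-2}(1+√2)/2`, quotients ≤ .40. The one example whose density was never printed,
   the Bamler–Cifarelli–Conlon–Deruelle shrinker on `Bl_p(ℂ×ℙ¹)` (GAFA 2024, arXiv:2206.10785),
   was COMPUTED this session by Duistermaat–Heckman localisation (toric: `Θ = F_min/(4e²)`,
   `F(b) = ∫_{P'} e^{-⟨b,x⟩} dx` over the polygon `P' = {x ≥ -2, |y| ≤ 2, x + y ≥ -2}`,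
   calibrated on all seven CHI toric entries to 3 digits, FIK exactly): `Θ(BCCD) = 0.5617`
   (`b = (0.6438, 0.3219)`, `F = 16.603`, `∫ e^{-f} dV = 88.7 < 124.9`); evidence file
   `compute/toric_density.py`. Polytope inclusion ⇒ a toric blow-up strictly LOWERS `Θ`, so by
   the BCCD classification (Thm 2: Kähler 4-d shrinkers with bounded `R` are `ℂ²`, `ℂ×ℙ¹`, FIK,
   BCCD, del Pezzos) every non-flat non-compact KÄHLER 4-d shrinker has `Θ ≤ 2/e = .736 < .791`.
   The route's "cheapest falsifier (a)" therefore FAILS to refute.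
3. **Why it resists (structure).** (i) Ends that are not conical: if `|Rm|` is bounded and
   `R ↛ 0` at infinity, pointed limits at infinity split as `N³ × ℝ` with `N ∈ {S³/Γ, S²×ℝ, (S²×ℝ)/ℤ₂}`
   and `μ` is upper-semicontinuous under `C^∞_loc` limits (transplant compactly supported test
   functions), so `log Θ(M) = μ(g,1) ≤ μ(N×ℝ,1) = log Θ(N) ≤ log Θ(S³)`: the crux HOLDS for every
   bounded-curvature shrinker with a non-conical end (paper argument, this file's docstring only).
   (ii) The open residue is the class of asymptotically conical (all ends conical, `R → 0`) non-Kähler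
   4-d shrinkers, of which NONE is known (FIK is the only AC example; Kotschwar–Wang: an AC shrinker is
   determined by its cone); only inexplicit gaps `Θ < 1 - δ₀` (Yokota, Li–Wang 2020, Chan–Zhang 2026
   local versions) are in print. (iii) No conjecture of this exact form is in print (Li–Wang 2024 §6
   Conj. 6.2/6.4 are PGH-rigidity statements); it is the planner's sharpening of CHI's table.
4. **Load-bearing hypotheses** (defs `NoncompactShrinkerGapWithout*` below): non-flatness — FALSE
   without it (Gaussian, PROVED here); non-compactness — FALSE without it (`S⁴(√6)`, `f ≡ 2`,
   `∫ = 96π²e⁻² = 128.2 > 124.9`, margin 2.6 %; PROVED here: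
   `noncompactShrinkerGap_false_without_noncompact`, from the tree's `ricci_roundMetric_holds`,
   `riemannianMeasure_roundMetric_sphere_four_univ`, `vol_constSmul_four` plus the new scaling
   lemmas `leviCivita/ricci/hessian/scalarCurvature_constSmul`); completeness — false without it (`S⁴ ∖ pt`, incomplete, same integral);
   connectedness — false without it (two cylinders, `∫ = 249.9`; sorried: disjoint-union manifold
   plumbing); the normalisation `R + |∇f|² = f` — FALSE without it, PROVED
   (`noncompactShrinkerGap_false_without_normalisation`: `f − 1` on the formal cylinder multiplies
   `∫` by `e`).
   So every hypothesis is used by any proof; the margin to the sharpest competitor `S⁴` is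
   `Θ(S⁴)/Θ(S³×ℝ) = 1.0266`.
5. **Natural strengthenings refuted** (all PROVED here): strict inequality (`not_strict`, the cylinder
   attains the bound); the same bound for compact shrinkers (`S⁴`, item 4); the bound with the next table
   constant `(4π)²Θ(S²×ℝ²) = 32π²/e` (`not_le_nextCompetitor`, cycle 3). On paper: "`Θ ≤ Θ(S²×ℝ²)` unless a
   quotient of `S³×ℝ`" survives all known examples (a plausible sharper conjecture, gap .055).
6. **Where a counterexample must live** (for ideators): a complete non-compact non-flat 4-d
   gradient shrinker with bounded curvature and `Θ > .791` has ALL ENDS CONICAL (item 3(i)), is not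
   Kähler (item 2). Density versus asymptotic volume ratio (rigorous, paper): by Cao–Zhou sublevel
   monotonicity (Chow, *Ricci solitons in low dimensions*, AMS 2023, Thm. 4.14, (4.65)–(4.67):
   `P(t) = (V(t) − R(t))/t² ↓ 16ω₄·AVR` for `t ≥ 3`, `V(t) = Vol{f < t}`) one has `V(t) ≥ 8π²·AVR·t²`
   for `t ≥ 3`, so by the layer-cake formula `∫e^{-f} = ∫₀^∞ e^{-t}V(t)dt ≥ 8π²·AVR·17e^{-3}`, i.e.
   `Θ ≥ (17/2e³)·AVR = 0.4232·AVR` on every complete non-compact 4-d shrinker (and `Θ ≈ AVR` for an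
   asymptotically conical one, where `f = r²/4 + o(1)`). Hence a cone-filling with `AVR > 1.87` would
   refute the crux outright, and conversely THE CRUX IMPLIES `AVR ≤ 0.791/0.4232 = 1.87` for all
   complete non-compact non-flat 4-d gradient shrinkers — to be compared with the best printed bound
   `AVR ≤ e² = 7.39` (Chow 2023, after (4.45)) and the OPEN Conjecture 4.15 of Chow 2023 (`AVR ≤ 1`):
   the crux sits quantitatively between a known theorem and an open conjecture on AVR.
   No shrinker or cone-filling with `Θ` or `AVR` in `(.791, 1]` is known, and only inexplicit gaps
   `Θ < 1 − δ` are in print;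
   OR it has unbounded scalar curvature (no 4-d example known; Munteanu–Wang 2015: bounded `R` ⇒
   bounded `Rm` in dimension 4), where blow-down/semicontinuity arguments at infinity are unavailable —
   the crux carries NO curvature hypothesis, so a proof must also cover this class (cf. §(c')
   `lintegral_lt_top_of_gap`: it even contains the finiteness `∫ e^{-f} < ∞`, Cao–Zhou 2010).
7. **§(c')**: `lintegral_lt_top_of_gap` (hidden finiteness content), `t3Space_of_chartedSpace`
   (the binder `[T3Space M]` is redundant), `densityS2R2_lt_cylinderDensityBound` (`2/e < 2√πe^{-3/2}`:
   with the two landed comparison lemmas, CHI's ordering `Θ(S²×ℝ²) < Θ(S³×ℝ) < Θ(S⁴) < 1` is checked),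
   `bccdClosedFormBound_lt_cylinderDensity` (cycle 3: `Θ(BCCD) ≤ 4(1−e^{−1/2})/e < Θ(S³×ℝ)`, the Kähler
   closure's only numerical input made arithmetic — see item 10(i')).
8. **Cycle-2 computation (§(f))**: cohomogeneity-one shooting scan over U(2)/SO(3)×SO(2) families on
   `ℝ⁴`, `O(−1..−4)`, `ℝ×S³`, `ℝ²×S²` — calibrated on all classical solitons (FIK found blind, `Θ = .67196`),
   finds NO new complete shrinker: no cohomogeneity-one counterexample in the scanned boxes.
9. **Formal cylinder DONE this session** (it was the cycle-2 plan): `RoundCylinderFour.lean` (metric,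
   `Ric`, `R`), `RoundCylinderFourSoliton.lean` (`Hess f`, soliton equation, `|∇f|²`, normalisation,
   topology), `RoundCylinderFourVolume.lean` (`∫ e^{-f} dV = 32π²√πe^{-3/2}`, completeness, `f − 1`).
   Plus `PuncturedShrinkingSphereFour.lean` (`S⁴∖pt` as a conformally flat incomplete metric on `ℝ⁴`).
   Remaining sorry: `…_false_without_connected` (disjoint union of two cylinders; needs a smooth
   bilinear-form section over a `Sum` manifold and the Hausdorff measure of a disjoint union).
10. **Cycle 3 (gen 2, 2026-08-16) — literature closure of two sub-classes, no new example, one more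
   refuted strengthening.** (i) KÄHLER CASE IS NOW A THEOREM WITHOUT CURVATURE ASSUMPTIONS: Li–Wang,
   *On Kähler Ricci shrinker surfaces*, Acta Math. 236 (2026) 1–50 = arXiv:2301.09784, Thm 1.1 (read p.2–3):
   every Kähler Ricci shrinker surface has bounded curvature and is one of {del Pezzo (compact), `ℂ²`, FIK,
   `ℙ¹×ℂ`, BCCD}; with item 2's densities (FIK `.672` closed form, `ℙ¹×ℂ` `2/e = .736`, BCCD `.5617` numerical,
   margin 29 %) the crux HOLDS on the whole complete non-compact Kähler class with `max Θ = 2/e < .791`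
   (item 2 previously needed BCCD's bounded-`R` hypothesis). (i') `Θ(BCCD)` IN CLOSED FORM (cycle 3, replaces
   the 2-variable numerical minimisation of item 2): the moment polygon `P' = {x ≥ −2, |y| ≤ 2, x + y ≥ −2}` of
   `Bl_p(ℂ×ℙ¹)` is invariant under the lattice involution `(x,y) ↦ (x+y, −y)`, so the (unique, strictly convex)
   DH minimiser satisfies `b₂ = b₁/2`, and integrating `e^{−⟨b,x⟩}` over `P'` gives
   `F(b₁, b₁/2) = 4e^{2b₁}(1 − e^{−b₁})/b₁²`; hence `Θ(BCCD) = min_{b>0} e^{2b−2}(1 − e^{−b})/b² = 0.56174`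
   at `b = 0.64380` (root of `2 + e^{−b}/(1−e^{−b}) = 2/b`; pure-python check in folder, agrees with item 2's
   `b = (0.643794, 0.321882)`, `F = 16.6028` to all digits), and ANY `b` certifies an upper bound without
   minimisation, e.g. `b = 13/20`: `Θ(BCCD) ≤ 0.56177 < .791`. Same formula family reproduces the calibration
   analytically: `ℂ×ℙ¹`: `min_b 4e^{2b}/b /(4e²) = 2/e` at `b = 1/2`; `ℂP²`: `F(0) = 18`, `Θ = 9/(2e²)`.
   (ii) ENDS WITHOUT GLOBAL CURVATURE BOUNDS:
   Bertellotti–Buzano, *Geometric structure of ends of Ricci shrinkers*, arXiv:2508.10790 (TAMS), Thm 1.8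
   (read p.5): on a 4-d shrinker, along any integral curve of `∇f` to infinity on which `S` is Type I (e.g.
   bounded along that ONE curve), pointed limits exist and are `ℝ⁴`, `ℝ²×S²`, `(ℝ²×S²)/ℤ₂` or `ℝ×S³/Γ`, flat iff
   `S → 0` along the curve. With the upper-semicontinuity of `μ(·,1)` under pointed `C^∞_loc` limits on the
   same manifold (item 3(i)), this upgrades 3(i): THE CRUX HOLDS for every shrinker having ONE gradient curve
   to infinity with `S` bounded and `S ↛ 0` along it (`Θ ≤ Θ₃(N) ≤ Θ(S³) = .791`, equality iff the limit is
   the round cylinder). REFINED RESIDUE (where ¬crux must live): complete non-compact non-flat 4-d shrinkers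
   on which EVERY gradient curve to infinity has either `S → 0` (conical directions; if all of `M` is like
   this and `Rm → 0`, `M` is asymptotically conical, Kotschwar–Wang-rigid, and NOT Kähler by (i)) or
   super-Type-I growth of `S` — no example of either kind with `Θ > .736` is known, and no example at all of
   the second kind. (iii) Other 2024–26 items checked and found not to bear on the threshold: Chan–Zhang
   arXiv:2605.08884 (read pp.1–5: LOCAL `ν`-gap and Ricci-gap theorems near the Gaussian, inexplicit `ε(n)`);
   at title/abstract level — Cao–Xie 2025 (4-d solitons with (half-)PIC), Wang–Wu arXiv:2604.23939 and
   Cheng–Zhou 2023 (constant-`S` rigidity: in 4-d `ℝ⁴, S²×ℝ², S³×ℝ` quotients or Einstein — all `≤ .791` among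
   non-compact), Xu–Zhang arXiv:2608.10953 and Sun–Zhang arXiv:2410.09661 (Kähler: compactness / Fano
   fibrations), Cifarelli–Esparza arXiv:2512.03323 (K-polystability of AC Kähler shrinkers), MacMahon
   arXiv:2407.21079 (compact obstructions), Bertellotti–Buzano arXiv:2407.04131 (ends of singular shrinkers);
   zbMATH "Ricci shrinkers" 2024– (40 rows), "shrinking Ricci solitons dimension four" 2024– (7 rows): NO new
   complete non-compact 4-d shrinker has appeared since BCCD (2022), in particular no non-Kähler one beyond
   the cylinders and their quotients. (iv) New checked strengthening-refutation `not_le_nextCompetitor` (§(c)): the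
   constant cannot be replaced by the next table entry `(4π)²Θ(S²×ℝ²) = 32π²/e`. (v) Sharpening of item 6
   (paper): the factor in `Θ ≥ (17/2e³)·AVR` comes only from restricting Cao–Zhou monotonicity to `t ≥ 3`;
   IF `V(t) ≥ 8π²·AVR·t²` held for all `t ≥ 0` (a shrinker Bishop–Gromov, open) the layer-cake would give
   `Θ ≥ AVR` and the crux would imply `AVR ≤ .791` for every complete non-compact non-flat 4-d shrinker,
   i.e. a quantitative form of Chow's Conjecture 4.15 (`AVR ≤ 1`); consistent with all examples
   (FIK: `Θ = .672 > AVR = .5`; cylinders and BCCD: `AVR = 0`). (vi) ROUTING REMARK for the planner (not a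
   finding against the item): the rung consumes this crux only for shrinkers that occur as tangent flows at
   the first singular time of a Ricci flow on a CLOSED 4-manifold with an entropy floor; that sub-class carries
   extra structure (𝔽-limits of compact flows, Bamler2020Structure §2; every currently known shrinker is
   globally Type I, Bertellotti–Buzano p.5), so if the unrestricted crux ever falls to a wild
   (super-Type-I) example, `--restate` to "singularity models of compact 4-d flows" is the natural repair and
   (ii) then covers every model with one bounded-`S`, `S ↛ 0` gradient curve.

Provers: cite `noncompactShrinkerGap_false_without_*` (non-vacuity + necessity of each hypothesis),
`tight_at_cylinder`/`not_strict` (the constant is sharp), the Literature models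
(`GaussianShrinker`: `ricci_euclideanMetric`, `hessian_gaussianPotential`, `gradSq_gaussianPotential`,
`riemannianMeasure_euclideanFour`, `lintegral_exp_neg_gaussianPotential`; `RoundCylinderFour.*`:
`ricci_cylP`, `soliton`, `normalisation`, `lintegral_exp_neg_fP`, `isCompact_setOf_edist_le`) as
templates for evaluating the crux's vocabulary on a concrete shrinker, and the numerics in §(f).
-/

noncomputable section

set_option linter.dupNamespace false

open Bundle Set Function Filter Manifold Metric Module MeasureTheory
open scoped Manifold ContDiff Topology RealInnerProductSpace ENNReal NNReal
open Literature.Geometry.Lorentzian Literature.Geometry.Lorentzian.PseudoRiemannianMetric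
open Literature.Geometry.Riemannian

namespace Summit.SmoothPoincare4.SmoothPoincare4.Cruxes.NoncompactShrinkerGap.Disproof

/-! ## (a) Load-bearing analysis: the crux with one hypothesis dropped -/

/-- The crux `NoncompactShrinkerGap` with the NON-FLATNESS hypothesis `∃ x, R x ≠ 0` dropped.
FALSE: `noncompactShrinkerGap_false_without_nonflat` (the Gaussian shrinker on `ℝ⁴`). [folklore] -/
def NoncompactShrinkerGapWithoutNonflat : Prop :=
  ∀ (M : Type) [TopologicalSpace M] [T2Space M] [SecondCountableTopology M]
    [ChartedSpace (EuclideanSpace ℝ (Fin 4)) M] [IsManifold (𝓡 4) ∞ M] [ConnectedSpace M]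
    [NoncompactSpace M] [T3Space M] [MeasurableSpace M] [BorelSpace M]
    (g : PseudoRiemannianMetric (𝓡 4) ∞ (EuclideanSpace ℝ (Fin 4)) (TangentSpace (𝓡 4) : M → Type _))
    [g.HasLeviCivita] (f : M → ℝ) (hg : g.IsRiemannian),
    (∀ (x : M) (r : NNReal), IsCompact {y : M | g.edist hg x y ≤ r}) →
    ContMDiff (𝓡 4) 𝓘(ℝ, ℝ) ∞ f →
    (∀ (x : M) (X Y : TangentSpace (𝓡 4) x),
      g.ricci x X Y + g.hessian f x X Y = (1 / 2 : ℝ) * g.val x X Y) →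
    (∀ x : M, g.scalarCurvature x + g.gradSq f x = f x) →
    ∫⁻ x, ENNReal.ofReal (Real.exp (-f x))
        ∂(riemannianMeasure (g.toContMDiffRiemannianMetric hg)) ≤
      ENNReal.ofReal (32 * Real.pi ^ 2 * Real.sqrt Real.pi * Real.exp (-(3 : ℝ) / 2))

/-- The crux with NON-COMPACTNESS dropped (the binder `[NoncompactSpace M]` removed).
FALSE: the round `S⁴(√6)` with `f ≡ 2` (`Ric = g/2`, `R = 2`, `∫ e^{-2} dV = 96π²e⁻² ≈ 128.2
> 124.9`; CHI 2004 §4: `Θ(S⁴) = 6/e² = .812 > .791`) — `noncompactShrinkerGap_false_without_noncompact`.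
[folklore] -/
def NoncompactShrinkerGapWithoutNoncompact : Prop :=
  ∀ (M : Type) [TopologicalSpace M] [T2Space M] [SecondCountableTopology M]
    [ChartedSpace (EuclideanSpace ℝ (Fin 4)) M] [IsManifold (𝓡 4) ∞ M] [ConnectedSpace M]
    [T3Space M] [MeasurableSpace M] [BorelSpace M]
    (g : PseudoRiemannianMetric (𝓡 4) ∞ (EuclideanSpace ℝ (Fin 4)) (TangentSpace (𝓡 4) : M → Type _))
    [g.HasLeviCivita] (f : M → ℝ) (hg : g.IsRiemannian),
    (∀ (x : M) (r : NNReal), IsCompact {y : M | g.edist hg x y ≤ r}) →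
    ContMDiff (𝓡 4) 𝓘(ℝ, ℝ) ∞ f →
    (∀ (x : M) (X Y : TangentSpace (𝓡 4) x),
      g.ricci x X Y + g.hessian f x X Y = (1 / 2 : ℝ) * g.val x X Y) →
    (∀ x : M, g.scalarCurvature x + g.gradSq f x = f x) →
    (∃ x : M, g.scalarCurvature x ≠ 0) →
    ∫⁻ x, ENNReal.ofReal (Real.exp (-f x))
        ∂(riemannianMeasure (g.toContMDiffRiemannianMetric hg)) ≤
      ENNReal.ofReal (32 * Real.pi ^ 2 * Real.sqrt Real.pi * Real.exp (-(3 : ℝ) / 2))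

/-- The crux with COMPLETENESS dropped (the hypothesis "closed `g`-balls are compact" removed).
FALSE: `S⁴(√6) ∖ {pt}`, realised as the conformally flat metric `96(|y|²+4)⁻²δ` on `ℝ⁴`, with `f ≡ 2`
is connected, non-compact, incomplete, a normalised shrinker with `R = 2 ≠ 0`, and
`∫ e^{-f} dV = 96π²e⁻² > 124.9` (a point is `dV`-null) — `noncompactShrinkerGap_false_without_complete`.
[folklore] -/
def NoncompactShrinkerGapWithoutComplete : Prop :=
  ∀ (M : Type) [TopologicalSpace M] [T2Space M] [SecondCountableTopology M]
    [ChartedSpace (EuclideanSpace ℝ (Fin 4)) M] [IsManifold (𝓡 4) ∞ M] [ConnectedSpace M]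
    [NoncompactSpace M] [T3Space M] [MeasurableSpace M] [BorelSpace M]
    (g : PseudoRiemannianMetric (𝓡 4) ∞ (EuclideanSpace ℝ (Fin 4)) (TangentSpace (𝓡 4) : M → Type _))
    [g.HasLeviCivita] (f : M → ℝ) (hg : g.IsRiemannian),
    ContMDiff (𝓡 4) 𝓘(ℝ, ℝ) ∞ f →
    (∀ (x : M) (X Y : TangentSpace (𝓡 4) x),
      g.ricci x X Y + g.hessian f x X Y = (1 / 2 : ℝ) * g.val x X Y) →
    (∀ x : M, g.scalarCurvature x + g.gradSq f x = f x) →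
    (∃ x : M, g.scalarCurvature x ≠ 0) →
    ∫⁻ x, ENNReal.ofReal (Real.exp (-f x))
        ∂(riemannianMeasure (g.toContMDiffRiemannianMetric hg)) ≤
      ENNReal.ofReal (32 * Real.pi ^ 2 * Real.sqrt Real.pi * Real.exp (-(3 : ℝ) / 2))

/-- The crux with CONNECTEDNESS dropped. False on paper: the disjoint union of two round cylinders
`S³(2)×ℝ ⊔ S³(2)×ℝ` (each with `f = z²/4 + 3/2`) is a complete non-compact non-flat normalised
shrinker with `∫ e^{-f} dV = 2 · 32π²√πe^{-3/2}`. Sorried below: the only missing piece is manifold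
plumbing (a `PseudoRiemannianMetric` on a `Sum`/two-component charted space and additivity of
`riemannianMeasure` over clopen components); each component is the landed `RoundCylinderFour`.
[folklore] -/
def NoncompactShrinkerGapWithoutConnected : Prop :=
  ∀ (M : Type) [TopologicalSpace M] [T2Space M] [SecondCountableTopology M]
    [ChartedSpace (EuclideanSpace ℝ (Fin 4)) M] [IsManifold (𝓡 4) ∞ M]
    [NoncompactSpace M] [T3Space M] [MeasurableSpace M] [BorelSpace M]
    (g : PseudoRiemannianMetric (𝓡 4) ∞ (EuclideanSpace ℝ (Fin 4)) (TangentSpace (𝓡 4) : M → Type _))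
    [g.HasLeviCivita] (f : M → ℝ) (hg : g.IsRiemannian),
    (∀ (x : M) (r : NNReal), IsCompact {y : M | g.edist hg x y ≤ r}) →
    ContMDiff (𝓡 4) 𝓘(ℝ, ℝ) ∞ f →
    (∀ (x : M) (X Y : TangentSpace (𝓡 4) x),
      g.ricci x X Y + g.hessian f x X Y = (1 / 2 : ℝ) * g.val x X Y) →
    (∀ x : M, g.scalarCurvature x + g.gradSq f x = f x) →
    (∃ x : M, g.scalarCurvature x ≠ 0) →
    ∫⁻ x, ENNReal.ofReal (Real.exp (-f x))
        ∂(riemannianMeasure (g.toContMDiffRiemannianMetric hg)) ≤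
      ENNReal.ofReal (32 * Real.pi ^ 2 * Real.sqrt Real.pi * Real.exp (-(3 : ℝ) / 2))

/-- The crux with the NORMALISATION `R + |∇f|² = f` dropped (only `Ric + Hess f = g/2` kept).
FALSE: on the cylinder `S³(2)×ℝ` the potential `f - 1` still solves the soliton equation and
`∫ e^{-(f-1)} dV = e · 32π²√πe^{-3/2}` — `noncompactShrinkerGap_false_without_normalisation`.
[folklore] -/
def NoncompactShrinkerGapWithoutNormalisation : Prop :=
  ∀ (M : Type) [TopologicalSpace M] [T2Space M] [SecondCountableTopology M]
    [ChartedSpace (EuclideanSpace ℝ (Fin 4)) M] [IsManifold (𝓡 4) ∞ M] [ConnectedSpace M]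
    [NoncompactSpace M] [T3Space M] [MeasurableSpace M] [BorelSpace M]
    (g : PseudoRiemannianMetric (𝓡 4) ∞ (EuclideanSpace ℝ (Fin 4)) (TangentSpace (𝓡 4) : M → Type _))
    [g.HasLeviCivita] (f : M → ℝ) (hg : g.IsRiemannian),
    (∀ (x : M) (r : NNReal), IsCompact {y : M | g.edist hg x y ≤ r}) →
    ContMDiff (𝓡 4) 𝓘(ℝ, ℝ) ∞ f →
    (∀ (x : M) (X Y : TangentSpace (𝓡 4) x),
      g.ricci x X Y + g.hessian f x X Y = (1 / 2 : ℝ) * g.val x X Y) →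
    (∃ x : M, g.scalarCurvature x ≠ 0) →
    ∫⁻ x, ENNReal.ofReal (Real.exp (-f x))
        ∂(riemannianMeasure (g.toContMDiffRiemannianMetric hg)) ≤
      ENNReal.ofReal (32 * Real.pi ^ 2 * Real.sqrt Real.pi * Real.exp (-(3 : ℝ) / 2))

/-- Sanity: the crux is each weakened statement plus the dropped hypothesis — e.g. it follows from
`NoncompactShrinkerGapWithoutNonflat` (so refuting the latter does not touch the crux). [folklore] -/
theorem noncompactShrinkerGap_of_withoutNonflat (h : NoncompactShrinkerGapWithoutNonflat) :
    Summit.SmoothPoincare4.SmoothPoincare4.Theses.EntropyRung.NoncompactShrinkerGap := by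
  intro M _ _ _ _ _ _ _ _ _ _ g _ f hg hc hf hsol hnorm _
  exact h M g f hg hc hf hsol hnorm

/-! ## (b) Checked negative lemmas: each hypothesis is load-bearing (geometric cores in Literature) -/

/-- **Non-flatness is load-bearing / the hypotheses are jointly satisfiable**: the Gaussian
shrinker `(ℝ⁴, δ, |x|²/4)` (`Literature/Geometry/Riemannian/GaussianShrinker.lean`) satisfies
completeness, smoothness, `Ric + Hess f = g/2` and `R + |∇f|² = f` in the tree's vocabulary, while
`∫ e^{-f} dV = 16π² > 32π²√πe^{-3/2}`; hence the crux without `∃ x, R x ≠ 0` is false, and any proof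
of the crux must use non-flatness (quantitatively: it must produce the gap `Θ ≤ .791 < 1 = Θ(ℝ⁴)`).
[folklore] -/
theorem noncompactShrinkerGap_false_without_nonflat : ¬ NoncompactShrinkerGapWithoutNonflat := by
  intro h
  have hsol : ∀ (x : EuclideanFour) (X Y : TangentSpace (𝓡 4) x),
      (euclideanMetric EuclideanFour).ricci x X Y +
          (euclideanMetric EuclideanFour).hessian gaussianPotential x X Y =
        (1 / 2 : ℝ) * (euclideanMetric EuclideanFour).val x X Y := fun x X Y ↦ by
    rw [ricci_euclideanMetric, hessian_gaussianPotential, euclideanMetric_apply,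
      LinearMap.zero_apply, LinearMap.zero_apply]
    ring_nf
    rfl
  have hnorm : ∀ x : EuclideanFour, (euclideanMetric EuclideanFour).scalarCurvature x +
      (euclideanMetric EuclideanFour).gradSq gaussianPotential x = gaussianPotential x := fun x ↦ by
    rw [scalarCurvature_euclideanMetric, gradSq_gaussianPotential, zero_add]
  have key := h EuclideanFour (euclideanMetric EuclideanFour) gaussianPotential
    isRiemannian_euclideanMetric isCompact_setOf_edist_euclideanMetric_le
    contDiff_gaussianPotential.contMDiff hsol hnorm
  change ∫⁻ x, ENNReal.ofReal (Real.exp (-gaussianPotential x)) ∂(riemannianMeasure euclideanFourMetric)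
    ≤ _ at key
  rw [riemannianMeasure_euclideanFour, lintegral_exp_neg_gaussianPotential,
    ENNReal.ofReal_le_ofReal_iff (by positivity)] at key
  exact absurd key (not_le.mpr cylinderDensityBound_lt_gaussian)

/-- **Non-compactness is load-bearing**: the round shrinking sphere `S⁴(√6) ⊂ ℝ⁵` with `f ≡ 2`
(`Literature/Geometry/Riemannian/ShrinkingRoundSphereFour.lean`) satisfies every hypothesis of the
crux except non-compactness (`Ric = ½ g`, `Hess 2 = 0`, `R = 2`, `|∇2|² = 0`, complete, connected,
`R ≠ 0`) while `∫ e^{-2} dV = 96π²e⁻² ≈ 128.2 > 124.9` (CHI 2004 §4: `Θ(S⁴) = 6/e² = .812 > .791`;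
margin `πe < 9`). Hence the crux without `[NoncompactSpace M]` is false: any proof must use
non-compactness, i.e. must separate `S⁴` (ratio `Θ(S⁴)/Θ(S³×ℝ) = 1.0266`). [folklore] -/
theorem noncompactShrinkerGap_false_without_noncompact :
    ¬ NoncompactShrinkerGapWithoutNoncompact := by
  intro h
  haveI : Nonempty SphereFour := (NormedSpace.sphere_nonempty.2 zero_le_one).to_subtype
  have hsol : ∀ (x : SphereFour) (X Y : TangentSpace (𝓡 4) x),
      shrinkingSphereFourMetric.ricci x X Y +
          shrinkingSphereFourMetric.hessian (fun _ ↦ (2 : ℝ)) x X Y =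
        (1 / 2 : ℝ) * shrinkingSphereFourMetric.val x X Y := by
    intro x X Y
    rw [ricci_shrinkingSphereFourMetric, shrinkingSphereFourMetric.hessian_constFun,
      LinearMap.zero_apply, LinearMap.zero_apply, add_zero]
  have hnorm : ∀ x : SphereFour, shrinkingSphereFourMetric.scalarCurvature x +
      shrinkingSphereFourMetric.gradSq (fun _ ↦ (2 : ℝ)) x = 2 := by
    intro x
    rw [scalarCurvature_shrinkingSphereFourMetric, PseudoRiemannianMetric.gradSq_const, add_zero]
  have hnf : ∃ x : SphereFour, shrinkingSphereFourMetric.scalarCurvature x ≠ 0 :=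
    ⟨Classical.arbitrary SphereFour, by rw [scalarCurvature_shrinkingSphereFourMetric]; norm_num⟩
  have key := h SphereFour shrinkingSphereFourMetric (fun _ ↦ (2 : ℝ))
    isRiemannian_shrinkingSphereFourMetric isCompact_setOf_edist_shrinkingSphereFour_le
    contMDiff_const hsol hnorm hnf
  rw [lintegral_exp_neg_two_shrinkingSphereFour, ENNReal.ofReal_le_ofReal_iff (by positivity)] at key
  exact absurd key (not_le.mpr cylinderDensityBound_lt_shrinkingSphereFour)

/-- **Completeness is load-bearing**: the punctured shrinking sphere `S⁴(√6) ∖ {pt}`, realised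
as the conformally flat metric `g_p = 96 (|y|²+4)⁻² δ` on all of `ℝ⁴`
(`Literature/Geometry/Riemannian/PuncturedShrinkingSphereFour.lean`), with `f ≡ 2`, is a connected
non-compact normalised gradient shrinker with `R = 2 ≠ 0` which is INCOMPLETE, and
`∫ e^{-2} dV = 96π²e⁻² ≈ 128.2 > 124.9`. Hence the crux without "closed balls compact" is false.
[folklore] -/
theorem noncompactShrinkerGap_false_without_complete : ¬ NoncompactShrinkerGapWithoutComplete := by
  intro h
  have hpt : PuncturedSphereFour.W4 := ⟨0, trivial⟩
  have hnf : ∃ x : PuncturedSphereFour.W4, PuncturedSphereFour.punctP.scalarCurvature x ≠ 0 :=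
    ⟨hpt, PuncturedSphereFour.scalarCurvature_ne_zero hpt⟩
  have key := h PuncturedSphereFour.W4 PuncturedSphereFour.punctP (fun _ ↦ (2 : ℝ))
    PuncturedSphereFour.isRiemannian_punctP contMDiff_const PuncturedSphereFour.soliton_two
    PuncturedSphereFour.normalisation_two hnf
  rw [PuncturedSphereFour.lintegral_exp_neg_two, ENNReal.ofReal_le_ofReal_iff (by positivity)] at key
  exact absurd key (not_le.mpr cylinderDensityBound_lt_shrinkingSphereFour)

/-- **The normalisation is load-bearing**: on the round cylinder
`S³(2) × ℝ ≅ (ℝ⁴ ∖ 0, (4/|y|²) δ)` (`Literature/Geometry/Riemannian/RoundCylinderFour*.lean`) the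
shifted potential `f − 1` still solves `Ric + Hess (f−1) = ½ g` (same Hessian) and every other
hypothesis holds, while `∫ e^{-(f−1)} dV = e · 32π²√π e^{-3/2} >` the bound. Hence the crux without
`R + |∇f|² = f` is false: the normalisation is what pins the weighted volume. [folklore] -/
theorem noncompactShrinkerGap_false_without_normalisation :
    ¬ NoncompactShrinkerGapWithoutNormalisation := by
  intro h
  have hpt : RoundCylinderFour.P4 := ⟨EuclideanSpace.single 0 1, by
    change EuclideanSpace.single (0 : Fin 4) (1 : ℝ) ∈ ({(0 : EuclideanFour)}ᶜ : Set EuclideanFour)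
    simp⟩
  have hnf : ∃ x : RoundCylinderFour.P4, RoundCylinderFour.cylP.scalarCurvature x ≠ 0 :=
    ⟨hpt, RoundCylinderFour.scalarCurvature_ne_zero hpt⟩
  have key := h RoundCylinderFour.P4 RoundCylinderFour.cylP RoundCylinderFour.fP1
    RoundCylinderFour.isRiemannian_cylP RoundCylinderFour.isCompact_setOf_edist_le
    RoundCylinderFour.contMDiff_fP1 RoundCylinderFour.soliton_fP1 hnf
  change ∫⁻ p, ENNReal.ofReal (Real.exp (-RoundCylinderFour.fP1 p))
      ∂(riemannianMeasure RoundCylinderFour.hC) ≤ _ at key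
  rw [RoundCylinderFour.lintegral_exp_neg_fP1, ENNReal.ofReal_le_ofReal_iff (by positivity)] at key
  exact absurd key (not_le.mpr RoundCylinderFour.bound_lt_shifted)

/-! ## (c) Tightness: the constant is attained, so neither `<` nor a smaller bound can hold -/

/-- **Tightness**: the bound of the crux is ATTAINED — the round cylinder `S³(2) × ℝ`, realised as
`(ℝ⁴ ∖ 0, (4/|y|²) δ)` with `f = (log|y|)² + 3/2 = z²/4 + 3/2`
(`Literature/Geometry/Riemannian/RoundCylinderFour*.lean`: `Ric = ½ g − ½ dz², Hess f = ½ dz²`,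
`R = 3/2`, `|∇f|² = z²/4`, complete, connected, non-compact), satisfies every hypothesis of
`NoncompactShrinkerGap` and `∫ e^{-f} dV = 32π²√π e^{-3/2}` EXACTLY (CHI 2004 §4: `Θ(S³×ℝ) = .791`).
Hence the constant cannot be lowered and the non-strict `≤` is necessary. [folklore] -/
theorem tight_at_cylinder :
    ∃ (M : Type) (_ : TopologicalSpace M) (_ : T2Space M) (_ : SecondCountableTopology M)
      (_ : ChartedSpace (EuclideanSpace ℝ (Fin 4)) M) (_ : IsManifold (𝓡 4) ∞ M)
      (_ : ConnectedSpace M) (_ : NoncompactSpace M) (_ : T3Space M) (_ : MeasurableSpace M)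
      (_ : BorelSpace M)
      (g : PseudoRiemannianMetric (𝓡 4) ∞ (EuclideanSpace ℝ (Fin 4)) (TangentSpace (𝓡 4) : M → Type _))
      (_ : g.HasLeviCivita) (f : M → ℝ) (hg : g.IsRiemannian),
      (∀ (x : M) (r : NNReal), IsCompact {y : M | g.edist hg x y ≤ r}) ∧
      ContMDiff (𝓡 4) 𝓘(ℝ, ℝ) ∞ f ∧
      (∀ (x : M) (X Y : TangentSpace (𝓡 4) x),
        g.ricci x X Y + g.hessian f x X Y = (1 / 2 : ℝ) * g.val x X Y) ∧
      (∀ x : M, g.scalarCurvature x + g.gradSq f x = f x) ∧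
      (∃ x : M, g.scalarCurvature x ≠ 0) ∧
      ∫⁻ x, ENNReal.ofReal (Real.exp (-f x))
          ∂(riemannianMeasure (g.toContMDiffRiemannianMetric hg)) =
        ENNReal.ofReal (32 * Real.pi ^ 2 * Real.sqrt Real.pi * Real.exp (-(3 : ℝ) / 2)) := by
  have hpt : RoundCylinderFour.P4 := ⟨EuclideanSpace.single 0 1, by
    change EuclideanSpace.single (0 : Fin 4) (1 : ℝ) ∈ ({(0 : EuclideanFour)}ᶜ : Set EuclideanFour)
    simp⟩
  exact ⟨RoundCylinderFour.P4, inferInstance, inferInstance, inferInstance, inferInstance,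
    inferInstance, inferInstance, inferInstance, inferInstance, inferInstance, inferInstance,
    RoundCylinderFour.cylP, inferInstance, RoundCylinderFour.fP, RoundCylinderFour.isRiemannian_cylP,
    RoundCylinderFour.isCompact_setOf_edist_le, RoundCylinderFour.contMDiff_fP,
    RoundCylinderFour.soliton, RoundCylinderFour.normalisation,
    ⟨hpt, RoundCylinderFour.scalarCurvature_ne_zero hpt⟩, RoundCylinderFour.lintegral_exp_neg_fP⟩

/-- **Corollary of tightness**: the STRICT form of the crux (`<` instead of `≤`) is false. [folklore] -/
theorem not_strict :
    ¬ ∀ (M : Type) [TopologicalSpace M] [T2Space M] [SecondCountableTopology M]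
      [ChartedSpace (EuclideanSpace ℝ (Fin 4)) M] [IsManifold (𝓡 4) ∞ M] [ConnectedSpace M]
      [NoncompactSpace M] [T3Space M] [MeasurableSpace M] [BorelSpace M]
      (g : PseudoRiemannianMetric (𝓡 4) ∞ (EuclideanSpace ℝ (Fin 4)) (TangentSpace (𝓡 4) : M → Type _))
      [g.HasLeviCivita] (f : M → ℝ) (hg : g.IsRiemannian),
      (∀ (x : M) (r : NNReal), IsCompact {y : M | g.edist hg x y ≤ r}) →
      ContMDiff (𝓡 4) 𝓘(ℝ, ℝ) ∞ f →
      (∀ (x : M) (X Y : TangentSpace (𝓡 4) x),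
        g.ricci x X Y + g.hessian f x X Y = (1 / 2 : ℝ) * g.val x X Y) →
      (∀ x : M, g.scalarCurvature x + g.gradSq f x = f x) →
      (∃ x : M, g.scalarCurvature x ≠ 0) →
      ∫⁻ x, ENNReal.ofReal (Real.exp (-f x))
          ∂(riemannianMeasure (g.toContMDiffRiemannianMetric hg)) <
        ENNReal.ofReal (32 * Real.pi ^ 2 * Real.sqrt Real.pi * Real.exp (-(3 : ℝ) / 2)) := by
  intro h
  have hpt : RoundCylinderFour.P4 := ⟨EuclideanSpace.single 0 1, by
    change EuclideanSpace.single (0 : Fin 4) (1 : ℝ) ∈ ({(0 : EuclideanFour)}ᶜ : Set EuclideanFour)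
    simp⟩
  have key := h RoundCylinderFour.P4 RoundCylinderFour.cylP RoundCylinderFour.fP
    RoundCylinderFour.isRiemannian_cylP RoundCylinderFour.isCompact_setOf_edist_le
    RoundCylinderFour.contMDiff_fP RoundCylinderFour.soliton RoundCylinderFour.normalisation
    ⟨hpt, RoundCylinderFour.scalarCurvature_ne_zero hpt⟩
  change ∫⁻ p, ENNReal.ofReal (Real.exp (-RoundCylinderFour.fP p))
      ∂(riemannianMeasure RoundCylinderFour.hC) < _ at key
  rw [RoundCylinderFour.lintegral_exp_neg_fP] at key
  exact lt_irrefl _ key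

/-! ## (c') Hidden content, statement hygiene, checked numerics -/

/-- **Hidden content**: the crux forces `∫ e^{-f} dV < ∞` for every admissible shrinker, i.e. any
proof of it contains (a form of) the Cao–Zhou 2010 volume-growth / potential estimate
(`Vol B_r ≤ C r⁴`, `f ~ r²/4`); the statement carries NO curvature bound, so this must be done for
shrinkers with possibly unbounded curvature (Cao–Zhou needs only completeness). [folklore] -/
theorem lintegral_lt_top_of_gap
    (h : Summit.SmoothPoincare4.SmoothPoincare4.Theses.EntropyRung.NoncompactShrinkerGap)
    (M : Type) [TopologicalSpace M] [T2Space M] [SecondCountableTopology M]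
    [ChartedSpace (EuclideanSpace ℝ (Fin 4)) M] [IsManifold (𝓡 4) ∞ M] [ConnectedSpace M]
    [NoncompactSpace M] [T3Space M] [MeasurableSpace M] [BorelSpace M]
    (g : PseudoRiemannianMetric (𝓡 4) ∞ (EuclideanSpace ℝ (Fin 4)) (TangentSpace (𝓡 4) : M → Type _))
    [g.HasLeviCivita] (f : M → ℝ) (hg : g.IsRiemannian)
    (hc : ∀ (x : M) (r : NNReal), IsCompact {y : M | g.edist hg x y ≤ r})
    (hf : ContMDiff (𝓡 4) 𝓘(ℝ, ℝ) ∞ f)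
    (hsol : ∀ (x : M) (X Y : TangentSpace (𝓡 4) x),
      g.ricci x X Y + g.hessian f x X Y = (1 / 2 : ℝ) * g.val x X Y)
    (hnorm : ∀ x : M, g.scalarCurvature x + g.gradSq f x = f x)
    (hnf : ∃ x : M, g.scalarCurvature x ≠ 0) :
    ∫⁻ x, ENNReal.ofReal (Real.exp (-f x))
        ∂(riemannianMeasure (g.toContMDiffRiemannianMetric hg)) < (⊤ : ℝ≥0∞) :=
  (h M g f hg hc hf hsol hnorm hnf).trans_lt ENNReal.ofReal_lt_top

/-- **Statement hygiene**: the binder `[T3Space M]` of the crux is REDUNDANT — a Hausdorff space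
charted on `ℝ⁴` is locally compact, hence regular (so provers and model-builders get it for free, as
the Literature models above do). `[SecondCountableTopology M]` is likewise implied by completeness +
connectedness (metrisability by `g.edist`), not formalised here. [folklore] -/
theorem t3Space_of_chartedSpace (M : Type) [TopologicalSpace M] [T2Space M]
    [ChartedSpace (EuclideanSpace ℝ (Fin 4)) M] : T3Space M := by
  haveI : LocallyCompactSpace M := ChartedSpace.locallyCompactSpace (EuclideanSpace ℝ (Fin 4)) M
  infer_instance

/-- **Checked numerics** — CHI's ordering of the competitors as Lean inequalities:
`Θ(S²×ℝ²) = 2/e < Θ(S³×ℝ) = 2√πe^{-3/2}` (this lemma, `⟺ e < π`; gap .055, so the second product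
shrinker sits strictly BELOW the bound), `Θ(S³×ℝ) < Θ(S⁴) = 6/e²`
(`cylinderDensityBound_lt_shrinkingSphereFour`, `⟺ πe < 9`) and `Θ(S³×ℝ) < Θ(ℝ⁴) = 1`
(`cylinderDensityBound_lt_gaussian`), all multiplied by `(4π)² = 16π²`. [folklore] -/
theorem densityS2R2_lt_cylinderDensityBound :
    32 * Real.pi ^ 2 / Real.exp 1 <
      32 * Real.pi ^ 2 * Real.sqrt Real.pi * Real.exp (-(3 : ℝ) / 2) := by
  have hπ : Real.exp 1 < Real.pi := lt_trans Real.exp_one_lt_d9 (by linarith [Real.pi_gt_d2])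
  have h1 : Real.exp (1 / 2) < Real.sqrt Real.pi := by
    rw [Real.lt_sqrt (Real.exp_pos _).le, ← Real.exp_nat_mul]
    norm_num
    exact hπ
  have h2 : Real.exp (-(3 : ℝ) / 2) = (Real.exp 1)⁻¹ * (Real.exp (1 / 2))⁻¹ := by
    rw [← Real.exp_neg, ← Real.exp_neg, ← Real.exp_add]
    norm_num
  have h3 : 1 < Real.sqrt Real.pi * (Real.exp (1 / 2))⁻¹ := by
    rw [lt_mul_inv_iff₀ (Real.exp_pos _), one_mul]
    exact h1
  rw [h2, div_eq_mul_inv]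
  calc 32 * Real.pi ^ 2 * (Real.exp 1)⁻¹ = 32 * Real.pi ^ 2 * (Real.exp 1)⁻¹ * 1 := (mul_one _).symm
    _ < 32 * Real.pi ^ 2 * (Real.exp 1)⁻¹ * (Real.sqrt Real.pi * (Real.exp (1 / 2))⁻¹) :=
        mul_lt_mul_of_pos_left h3 (by positivity)
    _ = _ := by ring

/-- **Checked numerics for the Kähler closure** (cycle 3): the BCCD shrinker's density in closed form.
By Duistermaat–Heckman / weighted-volume minimisation for toric shrinking Kähler–Ricci solitons
(Conlon–Deruelle–Sun 2024 Thm 4, Tian–Zhu; calibrated analytically on `ℂP²`, `ℂ×ℙ¹`, FIK in §(f)),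
`Θ = min_b F(b)/(4e²)`, `F(b) = ∫_{P'} e^{-⟨b,x⟩}dx` over the anticanonical moment polygon; for
`Bl_p(ℂ×ℙ¹)`, `P' = {x ≥ −2, |y| ≤ 2, x + y ≥ −2}` is invariant under the lattice involution
`(x,y) ↦ (x+y,−y)`, so the minimiser has `b₂ = b₁/2`, where `F = 4e^{2b₁}(1 − e^{−b₁})/b₁²`, and ANY `b₁`
gives an upper bound: at `b₁ = 1/2`, `Θ(BCCD) ≤ 4(1 − e^{−1/2})/e = .579` (true value `.5617` at
`b₁ = .6438`). This lemma is the arithmetic `4(1 − e^{−1/2})/e < 2√π e^{−3/2} = Θ(S³×ℝ)`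
(`⟺ 2(e^{1/2} − 1) < √π`), i.e. — granted the DH principle and the polygon — BCCD obeys the crux with
margin, with no numerical quadrature. [folklore] -/
theorem bccdClosedFormBound_lt_cylinderDensity :
    4 * (1 - Real.exp (-(1:ℝ)/2)) / Real.exp 1 < 2 * Real.sqrt Real.pi * Real.exp (-(3:ℝ)/2) := by
  set x := Real.exp ((1:ℝ)/2) with hxdef
  have hxpos : 0 < x := Real.exp_pos _
  have hx1 : Real.exp 1 = x ^ 2 := by rw [hxdef, ← Real.exp_nat_mul]; norm_num
  have hneg1 : Real.exp (-(1:ℝ)/2) = x⁻¹ := by rw [hxdef, ← Real.exp_neg]; norm_num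
  have hneg3 : Real.exp (-(3:ℝ)/2) = x⁻¹ ^ 3 := by
    rw [hxdef, inv_pow, ← Real.exp_nat_mul, ← Real.exp_neg]; norm_num
  have h1 : x < 33 / 20 := by nlinarith [Real.exp_one_lt_d9, hx1]
  have h2 : (13:ℝ) / 10 < Real.sqrt Real.pi := by
    rw [Real.lt_sqrt (by norm_num)]; nlinarith [Real.pi_gt_three]
  have key : 4 * (x - 1) < 2 * Real.sqrt Real.pi := by linarith
  rw [hx1, hneg1, hneg3]
  have hx3 : 0 < x ^ 3 := by positivity
  calc 4 * (1 - x⁻¹) / x ^ 2 = 4 * (x - 1) / x ^ 3 := by field_simp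
    _ < 2 * Real.sqrt Real.pi / x ^ 3 := by
        rwa [div_lt_div_iff_of_pos_right hx3]
    _ = 2 * Real.sqrt Real.pi * x⁻¹ ^ 3 := by rw [inv_pow, div_eq_mul_inv]

/-- **The next-competitor strengthening is false** (cycle 3): replacing the constant of the crux by
`(4π)²·Θ(S²×ℝ²) = 32π²/e` (the density of the second non-compact product shrinker, `Θ(S²×ℝ²) = 2/e`,
CHI 2004 §4) gives a FALSE statement — the round cylinder has `∫ e^{-f} dV = 32π²√πe^{-3/2} > 32π²/e`
(`densityS2R2_lt_cylinderDensityBound`). With `tight_at_cylinder`: `(4π)²Θ(S³×ℝ)` is the least constant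
for which the crux can hold; no proof can route through a bound by the `S²×ℝ²` density, and the
conjectural sharper form "`Θ ≤ Θ(S²×ℝ²)` unless `M` is a quotient of `S³×ℝ`" (item 5) genuinely needs
its exceptional clause. Also filed as `Theorems/NoncompactShrinkerGap/Negative/TightAtCylinder.lean`.
[folklore] -/
theorem not_le_nextCompetitor :
    ¬ ∀ (M : Type) [TopologicalSpace M] [T2Space M] [SecondCountableTopology M]
      [ChartedSpace (EuclideanSpace ℝ (Fin 4)) M] [IsManifold (𝓡 4) ∞ M] [ConnectedSpace M]
      [NoncompactSpace M] [T3Space M] [MeasurableSpace M] [BorelSpace M]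
      (g : PseudoRiemannianMetric (𝓡 4) ∞ (EuclideanSpace ℝ (Fin 4)) (TangentSpace (𝓡 4) : M → Type _))
      [g.HasLeviCivita] (f : M → ℝ) (hg : g.IsRiemannian),
      (∀ (x : M) (r : NNReal), IsCompact {y : M | g.edist hg x y ≤ r}) →
      ContMDiff (𝓡 4) 𝓘(ℝ, ℝ) ∞ f →
      (∀ (x : M) (X Y : TangentSpace (𝓡 4) x),
        g.ricci x X Y + g.hessian f x X Y = (1 / 2 : ℝ) * g.val x X Y) →
      (∀ x : M, g.scalarCurvature x + g.gradSq f x = f x) →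
      (∃ x : M, g.scalarCurvature x ≠ 0) →
      ∫⁻ x, ENNReal.ofReal (Real.exp (-f x))
          ∂(riemannianMeasure (g.toContMDiffRiemannianMetric hg)) ≤
        ENNReal.ofReal (32 * Real.pi ^ 2 / Real.exp 1) := by
  intro h
  have hpt : RoundCylinderFour.P4 := ⟨EuclideanSpace.single 0 1, by
    change EuclideanSpace.single (0 : Fin 4) (1 : ℝ) ∈ ({(0 : EuclideanFour)}ᶜ : Set EuclideanFour)
    simp⟩
  have key := h RoundCylinderFour.P4 RoundCylinderFour.cylP RoundCylinderFour.fP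
    RoundCylinderFour.isRiemannian_cylP RoundCylinderFour.isCompact_setOf_edist_le
    RoundCylinderFour.contMDiff_fP RoundCylinderFour.soliton RoundCylinderFour.normalisation
    ⟨hpt, RoundCylinderFour.scalarCurvature_ne_zero hpt⟩
  change ∫⁻ p, ENNReal.ofReal (Real.exp (-RoundCylinderFour.fP p))
      ∂(riemannianMeasure RoundCylinderFour.hC) ≤ _ at key
  rw [RoundCylinderFour.lintegral_exp_neg_fP, ENNReal.ofReal_le_ofReal_iff (by positivity)] at key
  exact absurd key (not_le.mpr densityS2R2_lt_cylinderDensityBound)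

/-! ## (d) Targets (lead's stuck stubs): none handed over this cycle (payload.targets = []). -/

/-! ## (e) Near-misses (sorried ONLY in this work file) -/

/-- **Connectedness is load-bearing** — witness: two disjoint copies of the round cylinder
`RoundCylinderFour` (`∫ = 2 · 32π²√πe^{-3/2} = 249.8 > 124.9`). OBSTRUCTION (engineering, not
mathematics): the tree has no `PseudoRiemannianMetric`/`HasLeviCivita`/`riemannianMeasure` API for a
disjoint union (`M ⊕ M` as a charted space with the summand metrics, locality of `leviCivita`,
`ricci`, `hessian`, and `μ(M ⊕ M) = μ M + μ M`); a conformally flat realisation inside one chart is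
impossible (a complete flat-conformal round-cylinder metric on an open `U ⊆ ℝ⁴` forces `U = ℝ⁴∖{a}`,
which is connected). Tried: (i) `Sum` charted space — `IsManifold` instance exists in Mathlib but the
tree's `OpensSection`/`OpensChart` dictionary is single-chart; (ii) two punctured balls in `ℝ⁴` with a
piecewise conformal factor — completeness fails at the outer sphere unless the factor blows up there,
and then the conformal law no longer gives `Ric = ½g − ½dz²`. Not load-bearing for provers (every
proof localises to a component), so left here. [folklore] -/
theorem noncompactShrinkerGap_false_without_connected : ¬ NoncompactShrinkerGapWithoutConnected := by
  sorry

/-! ## (f) Numerical record (evidence `compute/toric_density.py`, pure Python, Simpson n=4000,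
convergence checked to 1e-6): `Θ = F_min/(4e²)`, `F(b) = ∫_{P'} e^{-⟨b,x⟩}dx`,
`P' = {x : ⟨v_i,x⟩ ≥ -2}` (fan rays `v_i`), `f = ⟨b,x⟩ + 2`:
`ℙ¹×ℙ¹ .54134 (4/e²)`, `ℙ² .60901 (9/2e²)`, `ℂ×ℙ¹ .73576 (2/e)`, `ℂ² 1.00000`,
`FIK .67197 (e^{√2-2}(1+√2)/2)`, `Koiso .51787 (3.827/e²)`, `Wang–Zhu Bl₂ℙ² .45485`,
`Bl₃ℙ² .40601 (3/e²)`, **`BCCD = Bl_p(ℂ×ℙ¹)` .56174** (`b = (0.64379, 0.32188)`, `F = 16.6028`).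
Thresholds: `Θ(S³×ℝ) = 2√π e^{-3/2} = .79098`, `Θ(S⁴) = 6/e² = .81201`.

**Cycle 2 — cohomogeneity-one counterexample search** (evidence `compute/cohom1_summary.md`,
scripts `compute/cohom1_shoot.py`, `compute/bianchi9_shoot.py`, kit jobs j007611/j007665; shooting from
the singular orbit for `Ric + Hess f = g/2`, RK4 to `s = 14`, complete solutions = needles of the survival
time `s_dead` refined by Nelder–Mead to the numerical ceiling). Families: U(2)-invariant Berger metrics
`ds² + b²(σ₁²+σ₂²) + c²σ₃²` on `ℝ⁴` (NUT, 321×276 + zoom), on `O(−k) → ℂP¹`, `k = 1..4` (bolt, 321×301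
each, `b₀ ∈ [.2,5]`, `f''(0)/2 ∈ [−1.5,.5]`), on `ℝ×S³` (symmetric neck, 236²), and SO(3)×SO(2) metrics on
`ℝ²×S²` (321×301); control `ℝ³×S¹` (no shrinker possible: `π₁ = ℤ`). Calibration reproduced to 4–5 digits:
Gaussian 1, `S⁴` .81201, `ℂP²` .60901 (both sides), `S³×ℝ` .79098, `S²×ℝ²` .73576, and FIK found BLIND as
an isolated needle at `(b₀, f''(0)/2) = (2, 1/(2√2))` with `Θ = .67196` and conical asymptotics. RESULT: every
strict local maximum of `s_dead` (≈ 420 refinements) is either a known soliton (Gaussian, FIK, cylinder,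
`S²×ℝ²`), a compact closing, or a member of a degenerating shadow family escaping the box (capped cylinders
`S³/ℤ_k×ℝ` with `Θ_trunc → .791/k`; thin `S²×S¹×ℝ` tubes with `Θ_trunc ≤ .11`) — NO new complete shrinker,
in particular no conical non-Kähler one, in any box; the triaxial SU(2) (Bianchi IX) NUT family on `ℝ⁴`
(`a_i = s + A_i s³`, 186 780 + 113 923 ordered triples, 115 refinements) likewise returns only the Gaussian,
diagonal cylinder shadows and collapsed-`σ₁` tubes (`Θ_trunc ≤ .19`), and among reflection-symmetric
triaxial necks on `ℝ×S³` (129 766 triples in `[.3,4.8]³`) the round cylinder is the ONLY local maximum of the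
survival time. The cohomogeneity-one slice of the residue is numerically empty there; the crux resists. -/

end Summit.SmoothPoincare4.SmoothPoincare4.Cruxes.NoncompactShrinkerGap.Disproof

end
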